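import Summits.Ventures.LatticeQCDFlow.Exactness.Phi4MetropolisAcceptanceCSD
import HarnessLib

/-!
# Phase labels under the local arm: only a proposal long enough to REACH the level can flip the label

HONEST FRAMING: exact (Metropolis-corrected) sampling algorithms for lattice gauge theory;
figures of merit are autocorrelation/cost numbers at stated couplings and volumes; no
continuum-physics claim.  (SCALAR calibration rung S0-A: not a gauge result.)

Venture `LatticeQCDFlow` (cell pub-lqcd), topic `Exactness`; FANOUT row 2 (`s0-phi4`, LOCAL arm).
NEW WORK of the cell over `Exactness/Phi4MetropolisScan.lean` (row 2's random-site-scan Metropolis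
operator `metroScan J λ ρ` and its single-site hit `metroSite`).  Nothing is cited as a fact.  This file
is the carré-du-champ step of the BOTTLENECK floor drawn in
`Exactness/Phi4MetropolisPhaseLabelCSD.lean` (general collective variable) and
`Exactness/Phi4MetropolisSignTunnelling*.lean` (the `Z₂` order parameter `sgn M`).

## What is proved (`Λ = Fin (n+1)`, `V = n+1`; `ρ ≥ 0` a probability density, coercive action)

`F` a collective variable, `ℓ`-Lipschitz in each coordinate (`|F(φ|φ_x:=t') − F φ| ≤ ℓ |t' − φ_x|`),
`c` a level, the PHASE LABEL `θ(φ) = +1` if `c ≤ F φ`, `−1` otherwise, and the REACH functional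
`T(φ) = ∫ 1{|F φ − c| ≤ ℓ|u|} ρ(u) du` — the probability that the step law proposes an increment
long enough to reach the level from `φ`.

* `label_sq_sub_le_four`, `label_eq_of_abs_sub_lt`, `label_bddObs` — a flip costs at most `4` in
  square; a move of `F` shorter than the distance to the level cannot flip; `θ` is bounded measurable;
* `reach_mem_Icc`, `measurable_reach`, `reach_le_strip` — `T ∈ [0, 1]`, measurable, and for a step
  law vanishing outside `[−δ, δ]` (`ℓ ≥ 0`) `T ≤ 1{|F − c| ≤ ℓδ}` (the STRIP around the level);
* **`metroSite_labelDev_le`**, **`metroScan_labelDev_le`** — for every shift `a` (`g = θ − a`):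
  `M_x[(g − g φ)²](φ) ≤ 4 T(φ)` and `K[(g − g φ)²](φ) ≤ 4 T(φ)` at every configuration;
* **`integral_metroScan_labelDev_le`** — `∫ K[(g − g φ)²](φ) e^{−S} dφ ≤ 4 ∫ T e^{−S}`.

NOT CLAIMED here: any floor (next files); anything about the ordered sweep.
-/

namespace Summit.Ventures.LatticeQCDFlow.Exactness

open Real MeasureTheory Filter Finset
open Summit.Ventures.LatticeQCDFlow.Scoring

section PhaseLabelCarre

variable {n : ℕ}

/-! ## §1 Labels: a flip costs `4`, and a short move cannot flip -/

/-- Two `±1` labels differ by at most `4` in square. -/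
theorem label_sq_sub_le_four (a b : Prop) [Decidable a] [Decidable b] :
    ((if a then (1 : ℝ) else -1) - (if b then (1 : ℝ) else -1)) ^ 2 ≤ 4 := by
  split_ifs <;> norm_num

/-- **A move of `F` shorter than the distance to the level cannot flip the label**:
`|a − b| < |b − c| ⇒ θ_c(a) = θ_c(b)`. -/
theorem label_eq_of_abs_sub_lt {a b c : ℝ} (h : |a - b| < |b - c|) :
    (if c ≤ a then (1 : ℝ) else -1) = (if c ≤ b then (1 : ℝ) else -1) := by
  rcases abs_lt.mp h with ⟨h1, h2⟩
  by_cases hb : c ≤ b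
  · rw [abs_of_nonneg (sub_nonneg.mpr hb)] at h1 h2
    have ha : c ≤ a := by linarith
    rw [if_pos ha, if_pos hb]
  · push Not at hb
    rw [abs_of_neg (sub_neg.mpr hb)] at h1 h2
    have ha : ¬ c ≤ a := not_le.mpr (by linarith)
    rw [if_neg ha, if_neg (not_le.mpr hb)]

/-- The label is a bounded measurable observable (`F` measurable). -/
theorem label_bddObs {F : (Fin (n + 1) → ℝ) → ℝ} (hF : Measurable F) (c : ℝ) :
    BddObs (fun φ : Fin (n + 1) → ℝ => if c ≤ F φ then (1 : ℝ) else -1) := by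
  refine ⟨Measurable.ite (measurableSet_le measurable_const hF) measurable_const measurable_const,
    1, fun φ => ?_⟩
  show |(if c ≤ F φ then (1 : ℝ) else -1)| ≤ 1
  split_ifs <;> norm_num

/-! ## §2 The carré du champ of a label under the single-site hit and the scan -/

/-- The reach functional `T(φ) = ∫ 1{|F φ − c| ≤ ℓ|u|} ρ(u) du` lies in `[0, 1]`. -/
theorem reach_mem_Icc {ρ : ℝ → ℝ} (hρ0 : ∀ u, 0 ≤ ρ u) (hρi : Integrable ρ) (hρ1 : ∫ u, ρ u = 1)
    (F : (Fin (n + 1) → ℝ) → ℝ) (c ℓ : ℝ) (φ : Fin (n + 1) → ℝ) :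
    0 ≤ ∫ u, (if |F φ - c| ≤ ℓ * |u| then ρ u else 0)
      ∧ ∫ u, (if |F φ - c| ≤ ℓ * |u| then ρ u else 0) ≤ 1 := by
  refine ⟨integral_nonneg fun u => ?_, ?_⟩
  · split_ifs
    · exact hρ0 u
    · exact le_rfl
  · rw [← hρ1]
    refine integral_mono_of_nonneg (Eventually.of_forall fun u => ?_) hρi
      (Eventually.of_forall fun u => ?_)
    · show (0 : ℝ) ≤ if |F φ - c| ≤ ℓ * |u| then ρ u else 0
      split_ifs
      · exact hρ0 u
      · exact le_rfl
    · show (if |F φ - c| ≤ ℓ * |u| then ρ u else 0) ≤ ρ u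
      split_ifs
      · exact le_rfl
      · exact hρ0 u

/-- The reach functional is measurable in the configuration (`F`, `ρ` measurable). -/
theorem measurable_reach {ρ : ℝ → ℝ} (hρm : Measurable ρ) {F : (Fin (n + 1) → ℝ) → ℝ}
    (hF : Measurable F) (c ℓ : ℝ) :
    Measurable (fun φ : Fin (n + 1) → ℝ => ∫ u, (if |F φ - c| ≤ ℓ * |u| then ρ u else 0)) := by
  have hG : Measurable fun p : (Fin (n + 1) → ℝ) × ℝ =>
      (if |F p.1 - c| ≤ ℓ * |p.2| then ρ p.2 else 0) := by
    refine Measurable.ite ?_ (hρm.comp measurable_snd) measurable_const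
    exact measurableSet_le ((hF.comp measurable_fst).sub measurable_const).abs
      (measurable_const.mul (measurable_snd.abs))
  exact hG.stronglyMeasurable.integral_prod_right'.measurable

/-- **The hit's carré du champ of a label**: `F` `ℓ`-Lipschitz in the coordinate `x`, `θ` the label
of the level `c` shifted by any constant `a` (`g = θ − a`): `M_x[(g − g φ)²](φ) ≤ 4 T(φ)` — only
proposals long enough to reach the level can flip it. -/
theorem metroSite_labelDev_le (J : Fin (n + 1) → Fin (n + 1) → ℝ) (lam : ℝ) {ρ : ℝ → ℝ}
    (hρ0 : ∀ u, 0 ≤ ρ u) (hρm : Measurable ρ) (hρi : Integrable ρ) (x : Fin (n + 1))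
    {F : (Fin (n + 1) → ℝ) → ℝ} {c ℓ : ℝ} (a : ℝ) (φ : Fin (n + 1) → ℝ)
    (hlip : ∀ t', |F (Function.update φ x t') - F φ| ≤ ℓ * |t' - φ x|) :
    metroSite J lam ρ x (fun ψ => (((if c ≤ F ψ then (1 : ℝ) else -1) - a)
        - ((if c ≤ F φ then (1 : ℝ) else -1) - a)) ^ 2) φ
      ≤ 4 * ∫ u, (if |F φ - c| ≤ ℓ * |u| then ρ u else 0) := by
  have hρt : Integrable (fun t' => ρ (t' - φ x)) := hρi.comp_sub_right (φ x)
  -- the bound integrand, in the variable `t'`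
  have hcond : MeasurableSet {t' : ℝ | |F φ - c| ≤ ℓ * |t' - φ x|} :=
    measurableSet_le measurable_const (measurable_const.mul ((measurable_id.sub measurable_const).abs))
  have hBm : Measurable fun t' : ℝ => (if |F φ - c| ≤ ℓ * |t' - φ x| then ρ (t' - φ x) else 0) :=
    Measurable.ite hcond (hρm.comp (measurable_id.sub measurable_const)) measurable_const
  have hBi : Integrable (fun t' : ℝ => (if |F φ - c| ≤ ℓ * |t' - φ x| then ρ (t' - φ x) else 0)) := by
    refine Integrable.mono' hρt hBm.aestronglyMeasurable (Eventually.of_forall fun t' => ?_)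
    rw [Real.norm_eq_abs]
    split_ifs
    · rw [abs_of_nonneg (hρ0 _)]
    · rw [abs_zero]; exact hρ0 _
  -- change of variables `u = t' − φ_x` in the bound
  have hshift : ∫ t', (if |F φ - c| ≤ ℓ * |t' - φ x| then ρ (t' - φ x) else 0)
      = ∫ u, (if |F φ - c| ≤ ℓ * |u| then ρ u else 0) :=
    integral_sub_right_eq_self (μ := (volume : Measure ℝ))
      (fun u => if |F φ - c| ≤ ℓ * |u| then ρ u else 0) (φ x)
  unfold metroSite
  simp only [sub_self, zero_pow (two_ne_zero), mul_zero, add_zero]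
  rw [← hshift, ← integral_const_mul]
  refine integral_mono_of_nonneg (Eventually.of_forall fun t' => ?_) (hBi.const_mul 4)
    (Eventually.of_forall fun t' => ?_)
  · obtain ⟨ha0, -⟩ := metroAccept_nonneg_le J lam x φ t'
    exact mul_nonneg (mul_nonneg ha0 (sq_nonneg _)) (hρ0 _)
  · obtain ⟨ha0, ha1⟩ := metroAccept_nonneg_le J lam x φ t'
    show metroAccept J lam x φ t' * (((if c ≤ F (Function.update φ x t') then (1 : ℝ) else -1) - a)
        - ((if c ≤ F φ then (1 : ℝ) else -1) - a)) ^ 2 * ρ (t' - φ x)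
      ≤ 4 * (if |F φ - c| ≤ ℓ * |t' - φ x| then ρ (t' - φ x) else 0)
    have e : ((if c ≤ F (Function.update φ x t') then (1 : ℝ) else -1) - a)
        - ((if c ≤ F φ then (1 : ℝ) else -1) - a)
        = (if c ≤ F (Function.update φ x t') then (1 : ℝ) else -1)
          - (if c ≤ F φ then (1 : ℝ) else -1) := by ring
    rw [e]
    by_cases hreach : |F φ - c| ≤ ℓ * |t' - φ x|
    · rw [if_pos hreach]
      have h4 := label_sq_sub_le_four (c ≤ F (Function.update φ x t')) (c ≤ F φ)
      calc metroAccept J lam x φ t' * ((if c ≤ F (Function.update φ x t') then (1 : ℝ) else -1)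
            - (if c ≤ F φ then (1 : ℝ) else -1)) ^ 2 * ρ (t' - φ x)
          ≤ 1 * 4 * ρ (t' - φ x) :=
            mul_le_mul_of_nonneg_right (mul_le_mul ha1 h4 (sq_nonneg _) zero_le_one) (hρ0 _)
        _ = 4 * ρ (t' - φ x) := by ring
    · rw [if_neg hreach]
      have hlt : |F (Function.update φ x t') - F φ| < |F φ - c| :=
        lt_of_le_of_lt (hlip t') (lt_of_not_ge hreach)
      rw [label_eq_of_abs_sub_lt hlt, sub_self, zero_pow two_ne_zero, mul_zero, zero_mul, mul_zero]

/-- **The scan's carré du champ of a label**: `K[(g − g φ)²](φ) ≤ 4 T(φ)` (`F` `ℓ`-Lipschitz in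
every coordinate). -/
theorem metroScan_labelDev_le (J : Fin (n + 1) → Fin (n + 1) → ℝ) (lam : ℝ) {ρ : ℝ → ℝ}
    (hρ0 : ∀ u, 0 ≤ ρ u) (hρm : Measurable ρ) (hρi : Integrable ρ)
    {F : (Fin (n + 1) → ℝ) → ℝ} {c ℓ : ℝ} (a : ℝ) (φ : Fin (n + 1) → ℝ)
    (hlip : ∀ (x : Fin (n + 1)) (t' : ℝ), |F (Function.update φ x t') - F φ| ≤ ℓ * |t' - φ x|) :
    metroScan J lam ρ (fun ψ => (((if c ≤ F ψ then (1 : ℝ) else -1) - a)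
        - ((if c ≤ F φ then (1 : ℝ) else -1) - a)) ^ 2) φ
      ≤ 4 * ∫ u, (if |F φ - c| ≤ ℓ * |u| then ρ u else 0) := by
  have hn : (0 : ℝ) < (n : ℝ) + 1 := by positivity
  unfold metroScan
  rw [div_le_iff₀ hn]
  calc ∑ x, metroSite J lam ρ x (fun ψ => (((if c ≤ F ψ then (1 : ℝ) else -1) - a)
        - ((if c ≤ F φ then (1 : ℝ) else -1) - a)) ^ 2) φ
      ≤ ∑ _x : Fin (n + 1), 4 * ∫ u, (if |F φ - c| ≤ ℓ * |u| then ρ u else 0) :=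
        Finset.sum_le_sum fun x _ => metroSite_labelDev_le J lam hρ0 hρm hρi x a φ (hlip x)
    _ = (4 * ∫ u, (if |F φ - c| ≤ ℓ * |u| then ρ u else 0)) * ((n : ℝ) + 1) := by
        rw [Finset.sum_const, Finset.card_univ, Fintype.card_fin, nsmul_eq_mul]
        push_cast
        ring

/-- **Averaged form**: `∫ K[(g − g φ)²](φ) e^{−S} dφ ≤ 4 ∫ T e^{−S}` (coercive action). -/
theorem integral_metroScan_labelDev_le {J : Fin (n + 1) → Fin (n + 1) → ℝ} {lam ε K : ℝ}
    (hε : 0 < ε) (hS : ∀ φ : Fin (n + 1) → ℝ, ε * ∑ w, φ w ^ 2 - K ≤ latticePhi4Action J lam φ)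
    {ρ : ℝ → ℝ} (hρ0 : ∀ u, 0 ≤ ρ u) (hρm : Measurable ρ) (hρi : Integrable ρ)
    (hρ1 : ∫ u, ρ u = 1) {F : (Fin (n + 1) → ℝ) → ℝ} (hF : Measurable F) {c ℓ : ℝ} (a : ℝ)
    (hlip : ∀ (φ : Fin (n + 1) → ℝ) (x : Fin (n + 1)) (t' : ℝ),
      |F (Function.update φ x t') - F φ| ≤ ℓ * |t' - φ x|) :
    ∫ φ, metroScan J lam ρ (fun ψ => (((if c ≤ F ψ then (1 : ℝ) else -1) - a)
        - ((if c ≤ F φ then (1 : ℝ) else -1) - a)) ^ 2) φ * gibbsWeight J lam φ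
      ≤ 4 * ∫ φ, (∫ u, (if |F φ - c| ≤ ℓ * |u| then ρ u else 0)) * gibbsWeight J lam φ := by
  have hw := integrable_gibbsWeight_of_coercive hε hS
  have hTm := measurable_reach hρm hF c ℓ (n := n)
  have hTb : ∀ φ : Fin (n + 1) → ℝ, |∫ u, (if |F φ - c| ≤ ℓ * |u| then ρ u else 0)| ≤ 1 :=
    fun φ => by
      obtain ⟨h0, h1⟩ := reach_mem_Icc hρ0 hρi hρ1 F c ℓ φ
      rw [abs_of_nonneg h0]
      exact h1
  have hTi : Integrable (fun φ : Fin (n + 1) → ℝ =>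
      (∫ u, (if |F φ - c| ≤ ℓ * |u| then ρ u else 0)) * gibbsWeight J lam φ) :=
    integrable_bdd_mul_weight (μ := volume) hTm hTb (continuous_gibbsWeight J lam).measurable
      (fun φ => (gibbsWeight_pos J lam φ).le) hw
  rw [← integral_const_mul]
  refine integral_mono_of_nonneg (Eventually.of_forall fun φ => ?_) (hTi.const_mul 4)
    (Eventually.of_forall fun φ => ?_)
  · -- the scan of a nonnegative observable, evaluated anywhere, is nonnegative
    refine mul_nonneg ?_ (gibbsWeight_pos J lam φ).le
    unfold metroScan
    refine div_nonneg (Finset.sum_nonneg fun x _ => ?_) (by positivity)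
    unfold metroSite
    exact integral_nonneg fun t' => by
      obtain ⟨ha0, ha1⟩ := metroAccept_nonneg_le J lam x φ t'
      exact mul_nonneg (add_nonneg (mul_nonneg ha0 (sq_nonneg _))
        (mul_nonneg (sub_nonneg.2 ha1) (sq_nonneg _))) (hρ0 _)
  · have h := metroScan_labelDev_le J lam hρ0 hρm hρi a φ (hlip φ) (c := c)
    have hwφ := (gibbsWeight_pos J lam φ).le
    calc metroScan J lam ρ (fun ψ => (((if c ≤ F ψ then (1 : ℝ) else -1) - a)
          - ((if c ≤ F φ then (1 : ℝ) else -1) - a)) ^ 2) φ * gibbsWeight J lam φ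
        ≤ (4 * ∫ u, (if |F φ - c| ≤ ℓ * |u| then ρ u else 0)) * gibbsWeight J lam φ :=
          mul_le_mul_of_nonneg_right h hwφ
      _ = 4 * ((∫ u, (if |F φ - c| ≤ ℓ * |u| then ρ u else 0)) * gibbsWeight J lam φ) := by ring

/-- For a step law vanishing outside `[−δ, δ]` (`ℓ, δ ≥ 0`) the reach functional is dominated by
the indicator of the strip: `T(φ) ≤ 1{|F φ − c| ≤ ℓδ}`. -/
theorem reach_le_strip {ρ : ℝ → ℝ} (hρ0 : ∀ u, 0 ≤ ρ u) (hρi : Integrable ρ) (hρ1 : ∫ u, ρ u = 1)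
    {δ : ℝ} (hρδ : ∀ u, δ < |u| → ρ u = 0) {ℓ : ℝ} (hℓ : 0 ≤ ℓ)
    (F : (Fin (n + 1) → ℝ) → ℝ) (c : ℝ) (φ : Fin (n + 1) → ℝ) :
    ∫ u, (if |F φ - c| ≤ ℓ * |u| then ρ u else 0)
      ≤ (if |F φ - c| ≤ ℓ * δ then (1 : ℝ) else 0) := by
  by_cases hstrip : |F φ - c| ≤ ℓ * δ
  · rw [if_pos hstrip]
    exact (reach_mem_Icc hρ0 hρi hρ1 F c ℓ φ).2
  · rw [if_neg hstrip]
    have hzero : ∀ u, (if |F φ - c| ≤ ℓ * |u| then ρ u else 0) = 0 := by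
      intro u
      by_cases hu : |F φ - c| ≤ ℓ * |u|
      · rw [if_pos hu]
        apply hρδ
        by_contra hle
        push Not at hle
        exact hstrip (hu.trans (mul_le_mul_of_nonneg_left hle hℓ))
      · rw [if_neg hu]
    simp_rw [hzero, integral_zero]
    exact le_rfl

end PhaseLabelCarre

end Summit.Ventures.LatticeQCDFlow.Exactness
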